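import Summits.AtomisticToContinuum.Crystallization.Theorems.PalmUnimodularRigidityShellsToBarlowChartCharts
import Summits.AtomisticToContinuum.Crystallization.Theorems.PalmUnimodularRigidityShellsToBarlowChartTransportOpsDefs

/-!
# Two-shell rigidity at tolerance `1/20` — pattern facts and chart lemmas (R1a3 `stub_chartTransfer` of line `palm-good-law`, crux stmt-AtomisticToContinuum-13603, part 1/2)

Helper file for `Theorems/ReggeStarCoercivityDefectFreeCrystallizesChartTransfer.lean` (the registered stub R1a3 of the lead-c4
skeleton `Cruxes/DefectFreeCrystallizes/Lines/palm_good_law.lean`, v15).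

PATTERN FACTS.  The LINK of a label `t₀` in the integer kissing pattern `P ∈ {fcc3Int, hcpInt}` is the set of the four labels of
`P` at squared distance `18` from `t₀` (the labels of the common neighbours of the centre and of the neighbour labelled `t₀`).
Up to relabelling there are exactly two link figures:

* FCC-LIKE (`P = fcc3Int`, or `P = hcpInt` with `t₀` off the basal hexagon `t₀ 0 + t₀ 1 + t₀ 2 = 0`): the contact graph on the
  link is a perfect matching; every label of the link has, among the other three, one contact (`18`), one label at `36` and one
  at `54` (`link_pair_*`, `link_rowsum_*`, `link_rowpartner_*`, `link_onePartner_*`, `link_partner_*`, `link_nonpartner_*`);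
* HCP-BASAL (`P = hcpInt`, `t₀` basal): the link is `{c, i, e₁, e₂}` with contacts `c ~ e₁`, `c ~ e₂` only and squared
  distances `(c, i) = 54`, `(e₁, e₂) = 48`, `(eₖ, i) = 36` (`link_table_hcp_basal`).

All pattern statements are finite checks on `ℤ³`, proved by `decide`.

CHART LEMMAS (section `Charts`, hypothesis `hch` = the chart clauses of R1a1 `stub_goodCharts` with exact links: pattern
`fcc3Int`/`hcpInt`, scale in `[9/10, 11/10]`, labelling `nb x` bijective onto the bonded neighbours (distance in `(0, 6/5)`),
each label within `ac x / 20` of its ideal position, bond ↔ squared label distance `18`): readings of distances at tolerance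
`a/10` (`reading`), the label of the other end of a bond and the TRANSPORT of the link along the bond (`link_map`: the common
neighbour `nb x s` relabelled at `y` through the inverse labelling `zlab`), which is injective and preserves and reflects
contacts (`link_adj_iff`, `link_inj`).  Section `Metric`: the scale-product inequality `metric_kill` — two distances cannot read
`(36 at x, 54 at y)` and `(54 at x, 36 at y)` since `√3 − √2 > 1/5`.  All `[folklore]`.
-/

namespace Summit.AtomisticToContinuum.Crystallization.Theorems.PalmGoodLaw.ChartTransfer

open Literature.Geometry.DiscreteGeometry
open Summit.AtomisticToContinuum.Crystallization.Theorems.PalmUnimodularRigidityShellsToBarlowChart (fcc3Int)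

/-! ## FCC-like links: `fcc3Int` -/

/-- Two distinct non-touching labels of an FCC link are at squared distance `36` or `54`. [folklore] -/
theorem link_pair_fcc : ∀ t₀ ∈ fcc3Int, ∀ s₁ ∈ fcc3Int, ∀ s₂ ∈ fcc3Int,
    sqNormInt (s₁ - t₀) = 18 → sqNormInt (s₂ - t₀) = 18 → s₁ ≠ s₂ → sqNormInt (s₁ - s₂) ≠ 18 →
      (sqNormInt (s₁ - s₂) = 36 ∨ sqNormInt (s₁ - s₂) = 54) := by
  decide

/-- The two non-touching partners of a label in an FCC link read `36` and `54` (sum `90`). [folklore] -/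
theorem link_rowsum_fcc : ∀ t₀ ∈ fcc3Int, ∀ s₁ ∈ fcc3Int, ∀ s₂ ∈ fcc3Int, ∀ s₃ ∈ fcc3Int,
    sqNormInt (s₁ - t₀) = 18 → sqNormInt (s₂ - t₀) = 18 → sqNormInt (s₃ - t₀) = 18 →
      s₁ ≠ s₂ → s₁ ≠ s₃ → s₂ ≠ s₃ → sqNormInt (s₁ - s₂) ≠ 18 → sqNormInt (s₁ - s₃) ≠ 18 →
      sqNormInt (s₁ - s₂) + sqNormInt (s₁ - s₃) = 90 := by
  decide

/-- A non-touching pair of an FCC link has a row partner: a third link label not touching the first. [folklore] -/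
theorem link_rowpartner_fcc : ∀ t₀ ∈ fcc3Int, ∀ s₁ ∈ fcc3Int, ∀ s₂ ∈ fcc3Int,
    sqNormInt (s₁ - t₀) = 18 → sqNormInt (s₂ - t₀) = 18 → s₁ ≠ s₂ → sqNormInt (s₁ - s₂) ≠ 18 →
      ∃ s₃ ∈ fcc3Int, sqNormInt (s₃ - t₀) = 18 ∧ s₃ ≠ s₁ ∧ s₃ ≠ s₂ ∧ sqNormInt (s₁ - s₃) ≠ 18 := by
  decide

/-- In an FCC link every label touches at most one other link label. [folklore] -/
theorem link_onePartner_fcc : ∀ t₀ ∈ fcc3Int, ∀ c ∈ fcc3Int, ∀ d₁ ∈ fcc3Int, ∀ d₂ ∈ fcc3Int,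
    sqNormInt (c - t₀) = 18 → sqNormInt (d₁ - t₀) = 18 → sqNormInt (d₂ - t₀) = 18 →
      sqNormInt (c - d₁) = 18 → sqNormInt (c - d₂) = 18 → d₁ = d₂ := by
  decide

/-- In an FCC link every label touches some other link label. [folklore] -/
theorem link_partner_fcc : ∀ t₀ ∈ fcc3Int, ∀ s ∈ fcc3Int, sqNormInt (s - t₀) = 18 →
    ∃ r ∈ fcc3Int, sqNormInt (r - t₀) = 18 ∧ sqNormInt (s - r) = 18 := by
  decide

/-- In an FCC link every label has a non-touching companion. [folklore] -/
theorem link_nonpartner_fcc : ∀ t₀ ∈ fcc3Int, ∀ s ∈ fcc3Int, sqNormInt (s - t₀) = 18 →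
    ∃ s' ∈ fcc3Int, sqNormInt (s' - t₀) = 18 ∧ s' ≠ s ∧ sqNormInt (s - s') ≠ 18 := by
  decide

/-! ## FCC-like links: `hcpInt`, label off the basal hexagon -/

/-- Two distinct non-touching labels of a non-basal HCP link are at squared distance `36` or `54`. [folklore] -/
theorem link_pair_hcp : ∀ t₀ ∈ hcpInt, t₀ 0 + t₀ 1 + t₀ 2 ≠ 0 → ∀ s₁ ∈ hcpInt, ∀ s₂ ∈ hcpInt,
    sqNormInt (s₁ - t₀) = 18 → sqNormInt (s₂ - t₀) = 18 → s₁ ≠ s₂ → sqNormInt (s₁ - s₂) ≠ 18 →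
      (sqNormInt (s₁ - s₂) = 36 ∨ sqNormInt (s₁ - s₂) = 54) := by
  decide

/-- The two non-touching partners of a label in a non-basal HCP link read `36` and `54` (sum `90`). [folklore] -/
theorem link_rowsum_hcp : ∀ t₀ ∈ hcpInt, t₀ 0 + t₀ 1 + t₀ 2 ≠ 0 → ∀ s₁ ∈ hcpInt, ∀ s₂ ∈ hcpInt, ∀ s₃ ∈ hcpInt,
    sqNormInt (s₁ - t₀) = 18 → sqNormInt (s₂ - t₀) = 18 → sqNormInt (s₃ - t₀) = 18 →
      s₁ ≠ s₂ → s₁ ≠ s₃ → s₂ ≠ s₃ → sqNormInt (s₁ - s₂) ≠ 18 → sqNormInt (s₁ - s₃) ≠ 18 →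
      sqNormInt (s₁ - s₂) + sqNormInt (s₁ - s₃) = 90 := by
  decide

/-- A non-touching pair of a non-basal HCP link has a row partner. [folklore] -/
theorem link_rowpartner_hcp : ∀ t₀ ∈ hcpInt, t₀ 0 + t₀ 1 + t₀ 2 ≠ 0 → ∀ s₁ ∈ hcpInt, ∀ s₂ ∈ hcpInt,
    sqNormInt (s₁ - t₀) = 18 → sqNormInt (s₂ - t₀) = 18 → s₁ ≠ s₂ → sqNormInt (s₁ - s₂) ≠ 18 →
      ∃ s₃ ∈ hcpInt, sqNormInt (s₃ - t₀) = 18 ∧ s₃ ≠ s₁ ∧ s₃ ≠ s₂ ∧ sqNormInt (s₁ - s₃) ≠ 18 := by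
  decide

/-- In a non-basal HCP link every label touches at most one other link label. [folklore] -/
theorem link_onePartner_hcp : ∀ t₀ ∈ hcpInt, t₀ 0 + t₀ 1 + t₀ 2 ≠ 0 → ∀ c ∈ hcpInt, ∀ d₁ ∈ hcpInt, ∀ d₂ ∈ hcpInt,
    sqNormInt (c - t₀) = 18 → sqNormInt (d₁ - t₀) = 18 → sqNormInt (d₂ - t₀) = 18 →
      sqNormInt (c - d₁) = 18 → sqNormInt (c - d₂) = 18 → d₁ = d₂ := by
  decide

/-- In a non-basal HCP link every label touches some other link label. [folklore] -/
theorem link_partner_hcp : ∀ t₀ ∈ hcpInt, t₀ 0 + t₀ 1 + t₀ 2 ≠ 0 → ∀ s ∈ hcpInt, sqNormInt (s - t₀) = 18 →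
    ∃ r ∈ hcpInt, sqNormInt (r - t₀) = 18 ∧ sqNormInt (s - r) = 18 := by
  decide

/-- In a non-basal HCP link every label has a non-touching companion. [folklore] -/
theorem link_nonpartner_hcp : ∀ t₀ ∈ hcpInt, t₀ 0 + t₀ 1 + t₀ 2 ≠ 0 → ∀ s ∈ hcpInt, sqNormInt (s - t₀) = 18 →
    ∃ s' ∈ hcpInt, sqNormInt (s' - t₀) = 18 ∧ s' ≠ s ∧ sqNormInt (s - s') ≠ 18 := by
  decide

/-! ## HCP-basal links: the explicit table -/

/-- **The basal HCP link.**  For a basal label `t₀` of `hcpInt` the link consists of four labels `c, i, e₁, e₂` with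
contacts `c ~ e₁`, `c ~ e₂` and squared distances `(c, i) = 54`, `(e₁, e₂) = 48`, `(e₁, i) = (e₂, i) = 36`, and these four
labels are the whole link. [folklore] -/
theorem link_table_hcp_basal : ∀ t₀ ∈ hcpInt, t₀ 0 + t₀ 1 + t₀ 2 = 0 →
    ∃ c ∈ hcpInt, ∃ i ∈ hcpInt, ∃ e₁ ∈ hcpInt, ∃ e₂ ∈ hcpInt,
      sqNormInt (c - t₀) = 18 ∧ sqNormInt (i - t₀) = 18 ∧ sqNormInt (e₁ - t₀) = 18 ∧ sqNormInt (e₂ - t₀) = 18 ∧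
      sqNormInt (c - e₁) = 18 ∧ sqNormInt (c - e₂) = 18 ∧ sqNormInt (c - i) = 54 ∧
      sqNormInt (e₁ - e₂) = 48 ∧ sqNormInt (e₁ - i) = 36 ∧ sqNormInt (e₂ - i) = 36 ∧
      (∀ s ∈ hcpInt, sqNormInt (s - t₀) = 18 → s = c ∨ s = i ∨ s = e₁ ∨ s = e₂) := by
  decide


/-! ## Generic consequences of the chart clauses -/

section Charts

open Summit.AtomisticToContinuum.Crystallization.Theorems.PalmUnimodularRigidityShellsToBarlowChart
  (zlab dist_ideal sqNormInt_of_mem_fcc3Int sqNormInt_of_mem_hcpInt sqNormInt_sub_comm sqrt_bounds)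

variable {S : Set (EuclideanSpace ℝ (Fin 3))} {ac : EuclideanSpace ℝ (Fin 3) → ℝ}
  {Pc : EuclideanSpace ℝ (Fin 3) → Finset (Fin 3 → ℤ)}
  {Ac : EuclideanSpace ℝ (Fin 3) → (EuclideanSpace ℝ (Fin 3) →ₗᵢ[ℝ] EuclideanSpace ℝ (Fin 3))}
  {nb : EuclideanSpace ℝ (Fin 3) → (Fin 3 → ℤ) → EuclideanSpace ℝ (Fin 3)}

variable (hch : ∀ x ∈ S, (Pc x = fcc3Int ∨ Pc x = hcpInt) ∧ 9 / 10 ≤ ac x ∧ ac x ≤ 11 / 10 ∧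
    Set.BijOn (nb x) (↑(Pc x) : Set (Fin 3 → ℤ)) {y | y ∈ S ∧ (0 < dist x y ∧ dist x y < 6 / 5)} ∧
    (∀ t ∈ Pc x, dist (nb x t) (x + (ac x * (Real.sqrt 18)⁻¹) • Ac x (intVec t)) ≤ ac x / 20) ∧
    (∀ t ∈ Pc x, ∀ t' ∈ Pc x,
      ((0 < dist (nb x t) (nb x t') ∧ dist (nb x t) (nb x t') < 6 / 5) ↔ sqNormInt (t - t') = 18)))
include hch

/-- A labelled neighbour is a point of `S` bonded to the centre. [folklore] -/
theorem nb_mem {x : EuclideanSpace ℝ (Fin 3)} (hx : x ∈ S) {t : Fin 3 → ℤ} (ht : t ∈ Pc x) :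
    nb x t ∈ S ∧ (0 < dist x (nb x t) ∧ dist x (nb x t) < 6 / 5) :=
  (hch x hx).2.2.2.1.mapsTo ht

/-- The inverse labelling of a bonded neighbour is a label and labels it. [folklore] -/
theorem lab_spec {y z : EuclideanSpace ℝ (Fin 3)} (hy : y ∈ S) (hz : z ∈ S)
    (hb : 0 < dist y z ∧ dist y z < 6 / 5) : zlab Pc nb y z ∈ Pc y ∧ nb y (zlab Pc nb y z) = z := by
  have hmem : z ∈ {w | w ∈ S ∧ (0 < dist y w ∧ dist y w < 6 / 5)} := ⟨hz, hb⟩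
  obtain ⟨t, ht, htz⟩ := (hch y hy).2.2.2.1.surjOn hmem
  have hex : ∃ t ∈ (↑(Pc y) : Set (Fin 3 → ℤ)), nb y t = z := ⟨t, ht, htz⟩
  exact ⟨Function.invFunOn_mem hex, Function.invFunOn_eq hex⟩

/-- The inverse labelling inverts the labelling on labels. [folklore] -/
theorem lab_nb {y : EuclideanSpace ℝ (Fin 3)} (hy : y ∈ S) {t : Fin 3 → ℤ} (ht : t ∈ Pc y) :
    zlab Pc nb y (nb y t) = t :=
  (hch y hy).2.2.2.1.invOn_invFunOn.1 ht

/-- Exact links: bonds among labelled neighbours are the label pairs at squared distance `18`. [folklore] -/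
theorem links {x : EuclideanSpace ℝ (Fin 3)} (hx : x ∈ S) {t t' : Fin 3 → ℤ} (ht : t ∈ Pc x) (ht' : t' ∈ Pc x) :
    (0 < dist (nb x t) (nb x t') ∧ dist (nb x t) (nb x t') < 6 / 5) ↔ sqNormInt (t - t') = 18 :=
  (hch x hx).2.2.2.2.2 t ht t' ht'

/-- Labels are injective. [folklore] -/
theorem nb_inj {x : EuclideanSpace ℝ (Fin 3)} (hx : x ∈ S) {t t' : Fin 3 → ℤ} (ht : t ∈ Pc x) (ht' : t' ∈ Pc x)
    (h : nb x t = nb x t') : t = t' :=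
  (hch x hx).2.2.2.1.injOn ht ht' h

/-- Labels have squared norm `18`. [folklore] -/
theorem sqNormInt_label {x : EuclideanSpace ℝ (Fin 3)} (hx : x ∈ S) {t : Fin 3 → ℤ} (ht : t ∈ Pc x) :
    sqNormInt t = 18 := by
  rcases (hch x hx).1 with h | h
  · exact sqNormInt_of_mem_fcc3Int t (h ▸ ht)
  · exact sqNormInt_of_mem_hcpInt t (h ▸ ht)

/-- **Reading a distance in a `1/20`-chart**: two labelled neighbours `t, t'` of `x` are at distance
`(a/√18)·√(sqNormInt (t − t')) ± a/10`. [folklore] -/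
theorem reading {x : EuclideanSpace ℝ (Fin 3)} (hx : x ∈ S) {t t' : Fin 3 → ℤ} (ht : t ∈ Pc x) (ht' : t' ∈ Pc x) :
    |dist (nb x t) (nb x t') - ac x * (Real.sqrt 18)⁻¹ * Real.sqrt (sqNormInt (t - t') : ℝ)| ≤ ac x / 10 := by
  obtain ⟨-, ha9, -, -, hclose, -⟩ := hch x hx
  have h1 := hclose t ht
  have h2 := hclose t' ht'
  rw [← dist_ideal (by linarith) x (Ac x) t t']
  set p : EuclideanSpace ℝ (Fin 3) := x + (ac x * (Real.sqrt 18)⁻¹) • Ac x (intVec t)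
  set p' : EuclideanSpace ℝ (Fin 3) := x + (ac x * (Real.sqrt 18)⁻¹) • Ac x (intVec t')
  have e1 : |dist (nb x t) (nb x t') - dist p (nb x t')| ≤ dist (nb x t) p := _root_.abs_dist_sub_le _ _ _
  have e2 : |dist (nb x t') p - dist p' p| ≤ dist (nb x t') p' := _root_.abs_dist_sub_le _ _ _
  rw [dist_comm (nb x t') p, dist_comm p' p] at e2
  rw [abs_le] at e1 e2 ⊢
  constructor <;> linarith [e1.1, e1.2, e2.1, e2.2]

/-! ### The link of a bond and its transport to the other end -/

/-- The label of `y` at `x` is a label and labels `y`. [folklore] -/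
theorem lab_centre {x y : EuclideanSpace ℝ (Fin 3)} (hx : x ∈ S) (hy : y ∈ S) (hxy : 0 < dist x y ∧ dist x y < 6 / 5) :
    zlab Pc nb x y ∈ Pc x ∧ nb x (zlab Pc nb x y) = y :=
  lab_spec hch hx hy hxy

/-- A labelled neighbour of `x` bonded to `y` has a label touching the label of `y`. [folklore] -/
theorem adj_centre_of_bond {x y : EuclideanSpace ℝ (Fin 3)} (hx : x ∈ S) (hy : y ∈ S)
    (hxy : 0 < dist x y ∧ dist x y < 6 / 5) {s : Fin 3 → ℤ} (hs : s ∈ Pc x)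
    (hb : 0 < dist (nb x s) y ∧ dist (nb x s) y < 6 / 5) : sqNormInt (s - zlab Pc nb x y) = 18 := by
  obtain ⟨ht₀, hy'⟩ := lab_centre hch hx hy hxy
  rw [← links hch hx hs ht₀, hy']
  exact hb

/-- **Link transport.**  If the label `s` at `x` touches the label of `y`, then the point `nb x s` is a bonded neighbour of
`y`; its label at `y` labels it and touches the label of `x` at `y`. [folklore] -/
theorem link_map {x y : EuclideanSpace ℝ (Fin 3)} (hx : x ∈ S) (hy : y ∈ S) (hxy : 0 < dist x y ∧ dist x y < 6 / 5)
    {s : Fin 3 → ℤ} (hs : s ∈ Pc x) (hadj : sqNormInt (s - zlab Pc nb x y) = 18) :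
    zlab Pc nb y (nb x s) ∈ Pc y ∧ nb y (zlab Pc nb y (nb x s)) = nb x s ∧
      sqNormInt (zlab Pc nb y (nb x s) - zlab Pc nb y x) = 18 := by
  obtain ⟨ht₀, hy'⟩ := lab_centre hch hx hy hxy
  have hb : 0 < dist (nb x s) y ∧ dist (nb x s) y < 6 / 5 := by
    rw [← hy']; exact (links hch hx hs ht₀).2 hadj
  have hb' : 0 < dist y (nb x s) ∧ dist y (nb x s) < 6 / 5 := by rw [dist_comm]; exact hb
  have hsS := (nb_mem hch hx hs).1
  obtain ⟨hφ, hφs⟩ := lab_spec hch hy hsS hb'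
  have hyx : 0 < dist y x ∧ dist y x < 6 / 5 := by rw [dist_comm]; exact hxy
  obtain ⟨hu₀, hx'⟩ := lab_spec hch hy hx hyx
  refine ⟨hφ, hφs, ?_⟩
  rw [← links hch hy hφ hu₀, hφs, hx', dist_comm]
  exact (nb_mem hch hx hs).2

/-- Link transport preserves and reflects contacts. [folklore] -/
theorem link_adj_iff {x y : EuclideanSpace ℝ (Fin 3)} (hx : x ∈ S) (hy : y ∈ S) (hxy : 0 < dist x y ∧ dist x y < 6 / 5)
    {s₁ s₂ : Fin 3 → ℤ} (hs₁ : s₁ ∈ Pc x) (hs₂ : s₂ ∈ Pc x)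
    (h₁ : sqNormInt (s₁ - zlab Pc nb x y) = 18) (h₂ : sqNormInt (s₂ - zlab Pc nb x y) = 18) :
    sqNormInt (zlab Pc nb y (nb x s₁) - zlab Pc nb y (nb x s₂)) = 18 ↔ sqNormInt (s₁ - s₂) = 18 := by
  obtain ⟨hφ₁, hφs₁, -⟩ := link_map hch hx hy hxy hs₁ h₁
  obtain ⟨hφ₂, hφs₂, -⟩ := link_map hch hx hy hxy hs₂ h₂
  rw [← links hch hy hφ₁ hφ₂, hφs₁, hφs₂, links hch hx hs₁ hs₂]

/-- Link transport is injective. [folklore] -/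
theorem link_inj {x y : EuclideanSpace ℝ (Fin 3)} (hx : x ∈ S) (hy : y ∈ S) (hxy : 0 < dist x y ∧ dist x y < 6 / 5)
    {s₁ s₂ : Fin 3 → ℤ} (hs₁ : s₁ ∈ Pc x) (hs₂ : s₂ ∈ Pc x)
    (h₁ : sqNormInt (s₁ - zlab Pc nb x y) = 18) (h₂ : sqNormInt (s₂ - zlab Pc nb x y) = 18)
    (h : zlab Pc nb y (nb x s₁) = zlab Pc nb y (nb x s₂)) : s₁ = s₂ := by
  obtain ⟨-, hφs₁, -⟩ := link_map hch hx hy hxy hs₁ h₁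
  obtain ⟨-, hφs₂, -⟩ := link_map hch hx hy hxy hs₂ h₂
  have : nb x s₁ = nb x s₂ := by rw [← hφs₁, ← hφs₂, h]
  exact nb_inj hch hx hs₁ hs₂ this

end Charts

/-! ## FCC-like links: the pattern facts, uniformly in the pattern -/

section Like

open Summit.AtomisticToContinuum.Crystallization.Theorems.PalmUnimodularRigidityShellsToBarlowChart (sqNormInt_sub_comm)

/-- `hcpInt ≠ fcc3Int`. [folklore] -/
theorem hcpInt_ne_fcc3Int : hcpInt ≠ fcc3Int := by decide

/-- Anchor of this helper file (registered sub-goal of stmt-AtomisticToContinuum-13603, part 1/2 of `stub_chartTransfer`):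
the two integer patterns differ. [folklore] -/
theorem chartTransfer_part1_anchor : hcpInt ≠ fcc3Int := hcpInt_ne_fcc3Int

variable {P : Finset (Fin 3 → ℤ)} (hP : P = fcc3Int ∨ P = hcpInt) {t₀ : Fin 3 → ℤ} (ht₀ : t₀ ∈ P)
  (hF : P = fcc3Int ∨ t₀ 0 + t₀ 1 + t₀ 2 ≠ 0)
include hP ht₀ hF

/-- FCC-like link: non-touching distinct pairs read `36` or `54`. [folklore] -/
theorem like_pair {s₁ s₂ : Fin 3 → ℤ} (hs₁ : s₁ ∈ P) (hs₂ : s₂ ∈ P)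
    (h₁ : sqNormInt (s₁ - t₀) = 18) (h₂ : sqNormInt (s₂ - t₀) = 18) (hne : s₁ ≠ s₂)
    (hna : sqNormInt (s₁ - s₂) ≠ 18) : sqNormInt (s₁ - s₂) = 36 ∨ sqNormInt (s₁ - s₂) = 54 := by
  rcases hP with rfl | rfl
  · exact link_pair_fcc t₀ ht₀ s₁ hs₁ s₂ hs₂ h₁ h₂ hne hna
  · exact link_pair_hcp t₀ ht₀ (hF.resolve_left hcpInt_ne_fcc3Int) s₁ hs₁ s₂ hs₂ h₁ h₂ hne hna

/-- FCC-like link: the two non-touching partners of a label read `36` and `54`. [folklore] -/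
theorem like_rowsum {s₁ s₂ s₃ : Fin 3 → ℤ} (hs₁ : s₁ ∈ P) (hs₂ : s₂ ∈ P) (hs₃ : s₃ ∈ P)
    (h₁ : sqNormInt (s₁ - t₀) = 18) (h₂ : sqNormInt (s₂ - t₀) = 18) (h₃ : sqNormInt (s₃ - t₀) = 18)
    (h12 : s₁ ≠ s₂) (h13 : s₁ ≠ s₃) (h23 : s₂ ≠ s₃)
    (hna₂ : sqNormInt (s₁ - s₂) ≠ 18) (hna₃ : sqNormInt (s₁ - s₃) ≠ 18) :
    sqNormInt (s₁ - s₂) + sqNormInt (s₁ - s₃) = 90 := by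
  rcases hP with rfl | rfl
  · exact link_rowsum_fcc t₀ ht₀ s₁ hs₁ s₂ hs₂ s₃ hs₃ h₁ h₂ h₃ h12 h13 h23 hna₂ hna₃
  · exact link_rowsum_hcp t₀ ht₀ (hF.resolve_left hcpInt_ne_fcc3Int) s₁ hs₁ s₂ hs₂ s₃ hs₃ h₁ h₂ h₃ h12 h13 h23
      hna₂ hna₃

/-- FCC-like link: row partners exist. [folklore] -/
theorem like_rowpartner {s₁ s₂ : Fin 3 → ℤ} (hs₁ : s₁ ∈ P) (hs₂ : s₂ ∈ P)
    (h₁ : sqNormInt (s₁ - t₀) = 18) (h₂ : sqNormInt (s₂ - t₀) = 18) (hne : s₁ ≠ s₂)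
    (hna : sqNormInt (s₁ - s₂) ≠ 18) :
    ∃ s₃ ∈ P, sqNormInt (s₃ - t₀) = 18 ∧ s₃ ≠ s₁ ∧ s₃ ≠ s₂ ∧ sqNormInt (s₁ - s₃) ≠ 18 := by
  rcases hP with rfl | rfl
  · exact link_rowpartner_fcc t₀ ht₀ s₁ hs₁ s₂ hs₂ h₁ h₂ hne hna
  · exact link_rowpartner_hcp t₀ ht₀ (hF.resolve_left hcpInt_ne_fcc3Int) s₁ hs₁ s₂ hs₂ h₁ h₂ hne hna

/-- FCC-like link: at most one touching partner. [folklore] -/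
theorem like_onePartner {c d₁ d₂ : Fin 3 → ℤ} (hc : c ∈ P) (hd₁ : d₁ ∈ P) (hd₂ : d₂ ∈ P)
    (h₀ : sqNormInt (c - t₀) = 18) (h₁ : sqNormInt (d₁ - t₀) = 18) (h₂ : sqNormInt (d₂ - t₀) = 18)
    (hcd₁ : sqNormInt (c - d₁) = 18) (hcd₂ : sqNormInt (c - d₂) = 18) : d₁ = d₂ := by
  rcases hP with rfl | rfl
  · exact link_onePartner_fcc t₀ ht₀ c hc d₁ hd₁ d₂ hd₂ h₀ h₁ h₂ hcd₁ hcd₂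
  · exact link_onePartner_hcp t₀ ht₀ (hF.resolve_left hcpInt_ne_fcc3Int) c hc d₁ hd₁ d₂ hd₂ h₀ h₁ h₂ hcd₁ hcd₂

/-- FCC-like link: a touching partner exists. [folklore] -/
theorem like_partner {s : Fin 3 → ℤ} (hs : s ∈ P) (h : sqNormInt (s - t₀) = 18) :
    ∃ r ∈ P, sqNormInt (r - t₀) = 18 ∧ sqNormInt (s - r) = 18 := by
  rcases hP with rfl | rfl
  · exact link_partner_fcc t₀ ht₀ s hs h
  · exact link_partner_hcp t₀ ht₀ (hF.resolve_left hcpInt_ne_fcc3Int) s hs h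

/-- FCC-like link: a non-touching companion exists. [folklore] -/
theorem like_nonpartner {s : Fin 3 → ℤ} (hs : s ∈ P) (h : sqNormInt (s - t₀) = 18) :
    ∃ s' ∈ P, sqNormInt (s' - t₀) = 18 ∧ s' ≠ s ∧ sqNormInt (s - s') ≠ 18 := by
  rcases hP with rfl | rfl
  · exact link_nonpartner_fcc t₀ ht₀ s hs h
  · exact link_nonpartner_hcp t₀ ht₀ (hF.resolve_left hcpInt_ne_fcc3Int) s hs h

end Like

/-! ## The basal HCP table: touching pairs contain `c` -/

section Basal

open Summit.AtomisticToContinuum.Crystallization.Theorems.PalmUnimodularRigidityShellsToBarlowChart (sqNormInt_sub_comm)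

/-- `sqNormInt 0 ≠ 18`, in the form needed. [folklore] -/
theorem sqNormInt_sub_self_ne (v : Fin 3 → ℤ) : sqNormInt (v - v) ≠ 18 := by
  simp [sub_self, sqNormInt]

/-- In the basal HCP table, a touching pair of link labels contains `c`. [folklore] -/
theorem basal_adj_cases {c i e₁ e₂ a b : Fin 3 → ℤ}
    (hci : sqNormInt (c - i) = 54) (h12 : sqNormInt (e₁ - e₂) = 48) (h1i : sqNormInt (e₁ - i) = 36)
    (h2i : sqNormInt (e₂ - i) = 36)
    (ha : a = c ∨ a = i ∨ a = e₁ ∨ a = e₂) (hb : b = c ∨ b = i ∨ b = e₁ ∨ b = e₂)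
    (hab : sqNormInt (a - b) = 18) : a = c ∨ b = c := by
  rcases ha with rfl | rfl | rfl | rfl
  · exact Or.inl rfl
  · rcases hb with rfl | rfl | rfl | rfl
    · exact Or.inr rfl
    · exact absurd hab (sqNormInt_sub_self_ne _)
    · rw [sqNormInt_sub_comm] at hab; omega
    · rw [sqNormInt_sub_comm] at hab; omega
  · rcases hb with rfl | rfl | rfl | rfl
    · exact Or.inr rfl
    · omega
    · exact absurd hab (sqNormInt_sub_self_ne _)
    · omega
  · rcases hb with rfl | rfl | rfl | rfl
    · exact Or.inr rfl
    · omega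
    · rw [sqNormInt_sub_comm] at hab; omega
    · exact absurd hab (sqNormInt_sub_self_ne _)

end Basal

/-! ## The metric kill: no pair reads `36` at one end and `54` at the other, both ways -/

section Metric

open Summit.AtomisticToContinuum.Crystallization.Theorems.PalmUnimodularRigidityShellsToBarlowChart (sqrt_bounds)

/-- **Scale product inequality.**  Two distances cannot read `(√2·a ± a/10, √3·b ± b/10)` and `(√3·a ± a/10, √2·b ± b/10)`
for positive scales `a, b`: adding the two consequences `b(√3 − 1/10) ≤ a(√2 + 1/10)` and `a(√3 − 1/10) ≤ b(√2 + 1/10)` gives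
`√3 − √2 ≤ 1/5`, false. [folklore] -/
theorem metric_kill {a b d₁ d₂ : ℝ} (ha : 0 < a) (hb : 0 < b)
    (h1x : |d₁ - a * (Real.sqrt 18)⁻¹ * Real.sqrt 36| ≤ a / 10)
    (h1y : |d₁ - b * (Real.sqrt 18)⁻¹ * Real.sqrt 54| ≤ b / 10)
    (h2x : |d₂ - a * (Real.sqrt 18)⁻¹ * Real.sqrt 54| ≤ a / 10)
    (h2y : |d₂ - b * (Real.sqrt 18)⁻¹ * Real.sqrt 36| ≤ b / 10) : False := by
  obtain ⟨b18u, -, b36, -, -, b54l, -⟩ := sqrt_bounds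
  set K : ℝ := (Real.sqrt 18)⁻¹ with hK
  have h18 : (0 : ℝ) < Real.sqrt 18 := by positivity
  have hKpos : 0 < K := inv_pos.2 h18
  have hK18 : K * Real.sqrt 18 = 1 := inv_mul_cancel₀ h18.ne'
  rw [b36] at h1x h2y
  rw [abs_le] at h1x h1y h2x h2y
  -- the two one-sided consequences
  have i1 : b * K * Real.sqrt 54 - b / 10 ≤ a * K * 6 + a / 10 := by linarith [h1x.2, h1y.1]
  have i2 : a * K * Real.sqrt 54 - a / 10 ≤ b * K * 6 + b / 10 := by linarith [h2x.1, h2y.2]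
  -- their sum factors through `(a + b)`
  have hsum : (a + b) * (K * Real.sqrt 54 - 6 * K - 1 / 5) ≤ 0 := by nlinarith [i1, i2]
  have hfac : 0 < K * Real.sqrt 54 - 6 * K - 1 / 5 := by
    have hpos : 0 < Real.sqrt 54 - 6 - Real.sqrt 18 / 5 := by linarith
    have := mul_pos hKpos hpos
    have e : K * Real.sqrt 54 - 6 * K - 1 / 5 = K * (Real.sqrt 54 - 6 - Real.sqrt 18 / 5) := by
      have : (1 : ℝ) / 5 = K * Real.sqrt 18 / 5 := by rw [hK18]
      rw [this]; ring
    rw [e]; exact this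
  have : 0 < (a + b) * (K * Real.sqrt 54 - 6 * K - 1 / 5) := mul_pos (by linarith) hfac
  linarith

end Metric

end Summit.AtomisticToContinuum.Crystallization.Theorems.PalmGoodLaw.ChartTransfer
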